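import Summits.QuantumFields.YangMills.Theorems.BalabanLadderIRTwistedSlabOrbitMap
import Summits.QuantumFields.YangMills.Theorems.BalabanLadderIRTwistedSlabExpLine
import Literature.MathematicalPhysics.QuantumFieldTheory.Federbush1986.PureAveragesUNGauss
import Literature.MathematicalPhysics.QuantumFieldTheory.Balaban1983to89.B7Eq78Linearization
import Literature.Analysis.Matrix.DetExp
import HarnessLib

/-!
# The logarithmic slice chart `Ψ = Λ_L ∘ orbitFluct` at a background `L`: smooth near `0`, STRICTLY differentiable at `0` with
# differential `(φ, y) ↦ y − ∇⁺φ`, and `𝔰𝔲(N)`-valued on `𝔰𝔲`-data near `0` (calculus core of M1b, second half)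

HELPER toward stub **T1** `TwistedSlabAnchor` (LINE `twisted-slab-continuity`, crux `IRcof` stmt-QuantumFields-26930, census row 43;
LEAD prover ym-ir-line-tsc-p1 g3; `--supports` the crux, `--as helper`).  Sequel of K12 (`…OrbitMap`: `orbitFluct L (φ, y) = e^{φ} • (e^{y}·L)`,
`C^∞`, differential at `0`) and K10 (`…ExpLine`: `exp` of `𝔰𝔲` data is special unitary); consumes the tree's matrix logarithm
`MatrixLog.mlog` (series (21), `exp_mlog`, `analyticAt_mlog`), `B7Eq78Linearization.hasFDerivAt_mlog_one` (`D log(1) = id`),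
Federbush's `UNGauss.star_mlog_of_mem_unitaryGroup` (`log` of a unitary near `1` is skew, Frobenius norm) and Liouville's formula
`Literature.Analysis.Matrix.det_exp_eq_exp_trace` BY NAME.  All norms are the scoped Frobenius norms of K4/K5/K12.
* §1 `logFluct L U = (μ, x) ↦ log(U_μ(x) · L(x,μ)ᴴ)` (left logarithmic fluctuation coordinates at `L`), ★ `slicePsi L = logFluct L ∘ orbitFluct L`;
  `slicePsi_zero`; `contDiffAt_slicePsi` (`C^n` for every `n` wherever all `‖W − 1‖ < 1`, `W = orbitFluct·Lᴴ`); the candidate differential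
  `slicePsiDeriv L (φ, y) = (μ, x) ↦ y_μ(x) − ∇⁺_μ φ(x)` as a continuous linear map; `hasDerivAt_slicePsi_line`;
  ★★ `hasStrictFDerivAt_slicePsi_zero` : `HasStrictFDerivAt (slicePsi L) (slicePsiDeriv L) 0` for unitary `L` — the hypothesis of Mathlib's
  inverse function theorem (`HasStrictFDerivAt.toOpenPartialHomeomorph`) once restricted to spaces of equal dimension (K14 `realGaugeSliceEquiv`;
  done in the sequel); `exp_slicePsi_mul` : `exp(Ψ(p)_μ(x)) · L(x,μ) = orbitFluct L p (μ, x)` (the chart inverts the exponential coordinates).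
* §2 ★ `eventually_norm_orbitFluct_mul_conjTranspose_sub_one_lt` (the window condition holds near `0`), `orbitFluct_mem_specialUnitaryGroup`
  (`𝔰𝔲` data, `L ∈ SU(N)^E` ⇒ `orbitFluct ∈ SU(N)^E`), ★★ `eventually_slicePsi_skew_traceless`: near `p = 0`, on `𝔰𝔲` data the chart is
  `𝔰𝔲(N)`-valued (skew: Federbush's lemma; traceless: `e^{tr log W} = det W = 1` and `|tr log W| < 2π` by continuity).
NOT here (honest scope): the restriction to `suFields × realCoulombSlice → (Fin 4 → suFields)` and the IFT packaging (next file, with K14),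
the Haar densities and the `hchart` identity (lit-4 L10/L16), anything uniform in `β` (M3), the cluster expansion (M4); T1-box 0∕1, T1 proper 0∕1.

HONEST FRAMING: finite-dimensional calculus on one box; nothing here bears on `IRcof`, `IR`, or the Yang–Mills mass gap (Clay: NOT proved); R4 =
`BalabanLadder.UV` only.  References: M. García Pérez, A. González-Arroyo, M. Okawa, JHEP 10 (2017) 150 §2.3, §2.5 (background gauge fixing around
the twist eater); I. Montvay, G. Münster, *Quantum Fields on a Lattice* §3.2.5; S. Helgason, *Groups and Geometric Analysis* Ch. I §1 Thm 1.14.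
-/

set_option autoImplicit false

noncomputable section

open scoped Matrix Matrix.Norms.Frobenius Topology
open Finset NormedSpace Filter
open Literature.MathematicalPhysics.QuantumFieldTheory Literature.MathematicalPhysics.QuantumLattice
open Literature.Analysis.OperatorTheory
open Literature.MathematicalPhysics.QuantumFieldTheory.Balaban1983to89.MatrixLog (mlog mlog_def exp_mlog analyticAt_mlog)
open Literature.MathematicalPhysics.QuantumFieldTheory.Balaban1983to89.B7Eq78Linearization (hasFDerivAt_mlog_one)
open Literature.MathematicalPhysics.QuantumFieldTheory.Federbush1986.UNGauss (star_mlog_of_mem_unitaryGroup)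
open Literature.Analysis.Matrix (det_exp_eq_exp_trace)

namespace Summit.QuantumFields.YangMills.Cruxes.IRcof.TwistedSlab

variable {N : ℕ} {n₀ n₁ n₂ n₃ : ℕ}

/-! ## §1 The logarithmic slice chart and its strict differential at `0` -/

section Chart

variable (L : FinTorusSite n₀ n₁ n₂ n₃ × Fin 4 → Matrix (Fin N) (Fin N) ℂ)

/-- **Left logarithmic fluctuation coordinates at `L`**: `logFluct L U (μ, x) = log(U_μ(x) · L(x,μ)ᴴ)` (the series logarithm (21) of the
left fluctuation `W = U L⁻¹`, `L` unitary). [cite: GarciaperezGonzalezarroyoOkawa2017, §2.3, §2.5] -/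
def logFluct (U : Fin 4 → FinTorusSite n₀ n₁ n₂ n₃ → Matrix (Fin N) (Fin N) ℂ) :
    Fin 4 → FinTorusSite n₀ n₁ n₂ n₃ → Matrix (Fin N) (Fin N) ℂ :=
  fun μ x => mlog (U μ x * (L (x, μ))ᴴ)

/-- ★ **The logarithmic slice chart** `Ψ = Λ_L ∘ orbitFluct`: `slicePsi L (φ, y) (μ, x) = log(e^{φ(x)} e^{y_μ(x)} L(x,μ) e^{−φ(x+e_μ)} L(x,μ)ᴴ)` —
the orbit × fluctuation map read in the logarithmic coordinates at `L`. [cite: GarciaperezGonzalezarroyoOkawa2017, §2.3, §2.5] -/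
def slicePsi (p : (FinTorusSite n₀ n₁ n₂ n₃ → Matrix (Fin N) (Fin N) ℂ) × (Fin 4 → FinTorusSite n₀ n₁ n₂ n₃ → Matrix (Fin N) (Fin N) ℂ)) :
    Fin 4 → FinTorusSite n₀ n₁ n₂ n₃ → Matrix (Fin N) (Fin N) ℂ :=
  logFluct L (orbitFluct L p)

/-- Components of the chart. [folklore] -/
theorem slicePsi_apply (p : (FinTorusSite n₀ n₁ n₂ n₃ → Matrix (Fin N) (Fin N) ℂ) × (Fin 4 → FinTorusSite n₀ n₁ n₂ n₃ → Matrix (Fin N) (Fin N) ℂ))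
    (μ : Fin 4) (x : FinTorusSite n₀ n₁ n₂ n₃) : slicePsi L p μ x = mlog (orbitFluct L p μ x * (L (x, μ))ᴴ) := rfl

/-- `log 1 = 0` for the series logarithm (Frobenius-normed copy). [folklore] -/
private theorem mlog_one' : mlog (1 : Matrix (Fin N) (Fin N) ℂ) = 0 := by
  rw [mlog_def, sub_self, Literature.Analysis.Complex.logOnePlus_zero]

/-- The component maps `p ↦ orbitFluct L p (μ, x) · L(x,μ)ᴴ` are `C^∞`. [folklore] -/
theorem contDiff_orbitFluct_mul_conjTranspose (μ : Fin 4) (x : FinTorusSite n₀ n₁ n₂ n₃) :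
    ContDiff ℝ ⊤ (fun p : (FinTorusSite n₀ n₁ n₂ n₃ → Matrix (Fin N) (Fin N) ℂ) × (Fin 4 → FinTorusSite n₀ n₁ n₂ n₃ → Matrix (Fin N) (Fin N) ℂ) =>
      orbitFluct L p μ x * (L (x, μ))ᴴ) :=
  ((contDiff_apply_apply ℝ (Matrix (Fin N) (Fin N) ℂ) (n := ⊤) μ x).comp (contDiff_orbitFluct L)).mul contDiff_const

/-- **The candidate differential** `slicePsiDeriv L (φ, y) = (μ, x) ↦ y_μ(x) − ∇⁺_μ φ(x)` as a continuous linear map (finite dimension).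
[cite: GarciaperezGonzalezarroyoOkawa2017, §2.5] -/
def slicePsiDeriv : ((FinTorusSite n₀ n₁ n₂ n₃ → Matrix (Fin N) (Fin N) ℂ) × (Fin 4 → FinTorusSite n₀ n₁ n₂ n₃ → Matrix (Fin N) (Fin N) ℂ)) →L[ℝ]
    (Fin 4 → FinTorusSite n₀ n₁ n₂ n₃ → Matrix (Fin N) (Fin N) ℂ) :=
  LinearMap.toContinuousLinearMap
    { toFun := fun p μ x => p.2 μ x - covDeriv L μ p.1 x
      map_add' := fun p q => by
        funext μ x
        simp only [Prod.fst_add, Prod.snd_add, Pi.add_apply, covDeriv, covShift, Matrix.mul_add, Matrix.add_mul]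
        abel
      map_smul' := fun c p => by
        funext μ x
        simp only [Prod.smul_fst, Prod.smul_snd, Pi.smul_apply, RingHom.id_apply, covDeriv, covShift, Matrix.mul_smul, Matrix.smul_mul,
          smul_sub] }

/-- Components of the candidate differential. [folklore] -/
@[simp] theorem slicePsiDeriv_apply
    (p : (FinTorusSite n₀ n₁ n₂ n₃ → Matrix (Fin N) (Fin N) ℂ) × (Fin 4 → FinTorusSite n₀ n₁ n₂ n₃ → Matrix (Fin N) (Fin N) ℂ))
    (μ : Fin 4) (x : FinTorusSite n₀ n₁ n₂ n₃) : slicePsiDeriv L p μ x = p.2 μ x - covDeriv L μ p.1 x := rfl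

variable {L}

/-- At `p = 0` the left fluctuation is `L · Lᴴ = 1` (unitary background). [folklore] -/
theorem orbitFluct_zero_mul_conjTranspose (hL : ∀ e, L e ∈ Matrix.unitaryGroup (Fin N) ℂ) (μ : Fin 4) (x : FinTorusSite n₀ n₁ n₂ n₃) :
    orbitFluct L 0 μ x * (L (x, μ))ᴴ = 1 := by
  rw [orbitFluct_zero]
  have h : L (x, μ) * star (L (x, μ)) = 1 := Matrix.mem_unitaryGroup_iff.1 (hL (x, μ))
  simpa only [Matrix.star_eq_conjTranspose] using h

/-- `Ψ(0) = 0`. [folklore] -/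
theorem slicePsi_zero (hL : ∀ e, L e ∈ Matrix.unitaryGroup (Fin N) ℂ) : slicePsi L 0 = 0 := by
  funext μ x
  rw [slicePsi_apply, orbitFluct_zero_mul_conjTranspose hL, mlog_one']
  rfl

/-- **`Ψ` is `C^n` (every `n`) at every `p` whose fluctuations lie in the window `‖W − 1‖ < 1`** (composition of the `C^∞` orbit × fluctuation
map with the analytic series logarithm). [cite: Helgason2000, Ch. I §1 Thm 1.14 p. 96] -/
theorem contDiffAt_slicePsi
    {p : (FinTorusSite n₀ n₁ n₂ n₃ → Matrix (Fin N) (Fin N) ℂ) × (Fin 4 → FinTorusSite n₀ n₁ n₂ n₃ → Matrix (Fin N) (Fin N) ℂ)}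
    (hp : ∀ μ x, ‖orbitFluct L p μ x * (L (x, μ))ᴴ - 1‖ < 1) {n : WithTop ℕ∞} : ContDiffAt ℝ n (slicePsi L) p := by
  refine contDiffAt_pi.2 fun μ => contDiffAt_pi.2 fun x => ?_
  have h1 : ContDiffAt ℝ n (fun q : (FinTorusSite n₀ n₁ n₂ n₃ → Matrix (Fin N) (Fin N) ℂ) ×
      (Fin 4 → FinTorusSite n₀ n₁ n₂ n₃ → Matrix (Fin N) (Fin N) ℂ) => orbitFluct L q μ x * (L (x, μ))ᴴ) p :=
    ((contDiff_orbitFluct_mul_conjTranspose L μ x).of_le le_top).contDiffAt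
  have h2 : ContDiffAt ℝ n (mlog : Matrix (Fin N) (Fin N) ℂ → Matrix (Fin N) (Fin N) ℂ) (orbitFluct L p μ x * (L (x, μ))ᴴ) :=
    ((analyticAt_mlog (hp μ x)).contDiffAt).restrict_scalars ℝ
  exact h2.comp p h1

/-- **Line derivative of the chart at `0`**: `d/dt|₀ Ψ(t·(φ, y))_μ(x) = y_μ(x) − ∇⁺_μ φ(x)` (chain rule: `D log(1) = id`, K12's line derivative of
`orbitFluct`, `L Lᴴ = 1`). [cite: GarciaperezGonzalezarroyoOkawa2017, §2.5] -/
theorem hasDerivAt_slicePsi_line (hL : ∀ e, L e ∈ Matrix.unitaryGroup (Fin N) ℂ)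
    (φ : FinTorusSite n₀ n₁ n₂ n₃ → Matrix (Fin N) (Fin N) ℂ) (y : Fin 4 → FinTorusSite n₀ n₁ n₂ n₃ → Matrix (Fin N) (Fin N) ℂ)
    (μ : Fin 4) (x : FinTorusSite n₀ n₁ n₂ n₃) :
    HasDerivAt (fun t : ℝ => slicePsi L (t • (φ, y)) μ x) (y μ x - covDeriv L μ φ x) 0 := by
  have hc : HasDerivAt (fun t : ℝ => orbitFluct L (t • (φ, y)) μ x * (L (x, μ))ᴴ)
      (((φ x + y μ x) * L (x, μ) - L (x, μ) * φ (x.shift μ)) * (L (x, μ))ᴴ) 0 :=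
    (hasDerivAt_orbitFluct_line L φ y μ x).mul_const _
  have h0 : orbitFluct L ((0 : ℝ) • (φ, y)) μ x * (L (x, μ))ᴴ = 1 := by
    rw [zero_smul]; exact orbitFluct_zero_mul_conjTranspose hL μ x
  have hlog : HasFDerivAt (mlog : Matrix (Fin N) (Fin N) ℂ → Matrix (Fin N) (Fin N) ℂ)
      ((ContinuousLinearMap.id ℂ (Matrix (Fin N) (Fin N) ℂ)).restrictScalars ℝ) (orbitFluct L ((0 : ℝ) • (φ, y)) μ x * (L (x, μ))ᴴ) := by
    rw [h0]; exact (hasFDerivAt_mlog_one (𝔸 := Matrix (Fin N) (Fin N) ℂ)).restrictScalars ℝ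
  have h := hlog.comp_hasDerivAt (0 : ℝ) hc
  have hLL : L (x, μ) * (L (x, μ))ᴴ = 1 := by
    have h' : L (x, μ) * star (L (x, μ)) = 1 := Matrix.mem_unitaryGroup_iff.1 (hL (x, μ))
    simpa only [Matrix.star_eq_conjTranspose] using h'
  refine (h : HasDerivAt (fun t : ℝ => slicePsi L (t • (φ, y)) μ x) _ 0).congr_deriv ?_
  show ((φ x + y μ x) * L (x, μ) - L (x, μ) * φ (x.shift μ)) * (L (x, μ))ᴴ = y μ x - covDeriv L μ φ x
  rw [sub_mul, Matrix.mul_assoc (φ x + y μ x), hLL, Matrix.mul_one, covDeriv, covShift]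
  abel

/-- ★★ **THE CHART IS STRICTLY DIFFERENTIABLE AT `0` WITH DIFFERENTIAL `(φ, y) ↦ y − ∇⁺φ`** (unitary background): `C^∞` near `0` gives strict
differentiability with `fderiv`, and `fderiv` is identified on lines.  This is the hypothesis of the inverse function theorem for the tubular
coordinates of M1b. [cite: GarciaperezGonzalezarroyoOkawa2017, §2.5] [cite: MontvayMunster1994, §3.2.5 p. 122] -/
theorem hasStrictFDerivAt_slicePsi_zero (hL : ∀ e, L e ∈ Matrix.unitaryGroup (Fin N) ℂ) :
    HasStrictFDerivAt (slicePsi L) (slicePsiDeriv L) 0 := by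
  have hcd : ContDiffAt ℝ ⊤ (slicePsi L) 0 :=
    contDiffAt_slicePsi fun μ x => by rw [orbitFluct_zero_mul_conjTranspose hL, sub_self, norm_zero]; exact one_pos
  have hs : HasStrictFDerivAt (slicePsi L) (fderiv ℝ (slicePsi L) 0) 0 := hcd.hasStrictFDerivAt (by simp)
  have he : fderiv ℝ (slicePsi L) 0 = slicePsiDeriv L := by
    refine ContinuousLinearMap.ext fun p => ?_
    funext μ x
    obtain ⟨φ, y⟩ := p
    have h1 : HasDerivAt (fun t : ℝ => slicePsi L (t • (φ, y))) (fderiv ℝ (slicePsi L) 0 (φ, y)) 0 := by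
      have h := hs.hasFDerivAt.comp_hasDerivAt_of_eq (0 : ℝ) ((hasDerivAt_id' (0 : ℝ)).smul_const (φ, y)) (by rw [zero_smul])
      exact (h : HasDerivAt (fun t : ℝ => slicePsi L (t • (φ, y))) _ 0).congr_deriv
        (congrArg (fderiv ℝ (slicePsi L) 0) (one_smul ℝ (φ, y)))
    have h2 : HasDerivAt (fun t : ℝ => slicePsi L (t • (φ, y)) μ x) (fderiv ℝ (slicePsi L) 0 (φ, y) μ x) 0 :=
      hasDerivAt_pi.1 (hasDerivAt_pi.1 h1 μ) x
    rw [slicePsiDeriv_apply]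
    exact h2.unique (hasDerivAt_slicePsi_line hL φ y μ x)
  rw [← he]
  exact hs

/-- **The chart inverts the exponential coordinates**: `exp(Ψ(p)_μ(x)) · L(x,μ) = orbitFluct L p (μ, x)` inside the window `‖W − 1‖ < 1`.
[cite: Helgason2000, Ch. I §1 Thm 1.14 p. 96] -/
theorem exp_slicePsi_mul (hL : ∀ e, L e ∈ Matrix.unitaryGroup (Fin N) ℂ)
    {p : (FinTorusSite n₀ n₁ n₂ n₃ → Matrix (Fin N) (Fin N) ℂ) × (Fin 4 → FinTorusSite n₀ n₁ n₂ n₃ → Matrix (Fin N) (Fin N) ℂ)}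
    {μ : Fin 4} {x : FinTorusSite n₀ n₁ n₂ n₃} (hp : ‖orbitFluct L p μ x * (L (x, μ))ᴴ - 1‖ < 1) :
    exp (slicePsi L p μ x) * L (x, μ) = orbitFluct L p μ x := by
  have h1 : exp (mlog (orbitFluct L p μ x * (L (x, μ))ᴴ)) = orbitFluct L p μ x * (L (x, μ))ᴴ := exp_mlog hp
  have h2 : (L (x, μ))ᴴ * L (x, μ) = 1 := by
    have h' : star (L (x, μ)) * L (x, μ) = 1 := Matrix.mem_unitaryGroup_iff'.1 (hL (x, μ))
    simpa only [Matrix.star_eq_conjTranspose] using h'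
  calc exp (slicePsi L p μ x) * L (x, μ) = orbitFluct L p μ x * (L (x, μ))ᴴ * L (x, μ) := congrArg (· * L (x, μ)) h1
    _ = orbitFluct L p μ x := by rw [Matrix.mul_assoc, h2, Matrix.mul_one]

end Chart

/-! ## §2 The window condition and `𝔰𝔲(N)`-valuedness near `0` -/

section SU

variable {L : FinTorusSite n₀ n₁ n₂ n₃ × Fin 4 → Matrix (Fin N) (Fin N) ℂ}

/-- ★ **The window condition holds near `0`**: for every `ε > 0`, eventually (in `p → 0`) all left fluctuations satisfy `‖W_μ(x) − 1‖ < ε`.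
[cite: Helgason2000, Ch. I §1 Thm 1.14 p. 96] -/
theorem eventually_norm_orbitFluct_mul_conjTranspose_sub_one_lt (hL : ∀ e, L e ∈ Matrix.unitaryGroup (Fin N) ℂ) {ε : ℝ} (hε : 0 < ε) :
    ∀ᶠ p in 𝓝 (0 : (FinTorusSite n₀ n₁ n₂ n₃ → Matrix (Fin N) (Fin N) ℂ) × (Fin 4 → FinTorusSite n₀ n₁ n₂ n₃ → Matrix (Fin N) (Fin N) ℂ)),
      ∀ μ x, ‖orbitFluct L p μ x * (L (x, μ))ᴴ - 1‖ < ε := by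
  refine Filter.eventually_all.2 fun μ => Filter.eventually_all.2 fun x => ?_
  have hc : ContinuousAt (fun p : (FinTorusSite n₀ n₁ n₂ n₃ → Matrix (Fin N) (Fin N) ℂ) ×
      (Fin 4 → FinTorusSite n₀ n₁ n₂ n₃ → Matrix (Fin N) (Fin N) ℂ) => orbitFluct L p μ x * (L (x, μ))ᴴ) 0 :=
    (contDiff_orbitFluct_mul_conjTranspose L μ x).continuous.continuousAt
  have h := Metric.tendsto_nhds.1 hc ε hε
  refine h.mono fun p hp => ?_
  dsimp only at hp
  rwa [orbitFluct_zero_mul_conjTranspose hL μ x, dist_eq_norm] at hp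

/-- The conjugate transpose of a special unitary matrix is special unitary. [folklore] -/
private theorem conjTranspose_mem_specialUnitaryGroup {U : Matrix (Fin N) (Fin N) ℂ} (hU : U ∈ Matrix.specialUnitaryGroup (Fin N) ℂ) :
    Uᴴ ∈ Matrix.specialUnitaryGroup (Fin N) ℂ := by
  rw [Matrix.mem_specialUnitaryGroup_iff] at hU ⊢
  refine ⟨Matrix.mem_unitaryGroup_iff.2 ?_, by rw [Matrix.det_conjTranspose, hU.2, star_one]⟩
  have h : star U * U = 1 := Matrix.mem_unitaryGroup_iff'.1 hU.1
  simpa only [Matrix.star_eq_conjTranspose, Matrix.conjTranspose_conjTranspose] using h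

/-- **`𝔰𝔲` data and a special unitary background give special unitary configurations**: `orbitFluct L (φ, y) ∈ SU(N)^E` for skew-Hermitian
traceless `φ, y` and `L ∈ SU(N)^E` (K10 `exp_mem_specialUnitaryGroup_of_conjTranspose`). [cite: MontvayMunster1994, §3.2.5 p. 122] -/
theorem orbitFluct_mem_specialUnitaryGroup (hL : ∀ e, L e ∈ Matrix.specialUnitaryGroup (Fin N) ℂ)
    {p : (FinTorusSite n₀ n₁ n₂ n₃ → Matrix (Fin N) (Fin N) ℂ) × (Fin 4 → FinTorusSite n₀ n₁ n₂ n₃ → Matrix (Fin N) (Fin N) ℂ)}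
    (hφ : ∀ x, (p.1 x)ᴴ = -p.1 x ∧ (p.1 x).trace = 0) (hy : ∀ μ x, (p.2 μ x)ᴴ = -p.2 μ x ∧ (p.2 μ x).trace = 0)
    (μ : Fin 4) (x : FinTorusSite n₀ n₁ n₂ n₃) : orbitFluct L p μ x ∈ Matrix.specialUnitaryGroup (Fin N) ℂ := by
  have h1 := exp_mem_specialUnitaryGroup_of_conjTranspose (hφ x).1 (hφ x).2
  have h2 := exp_mem_specialUnitaryGroup_of_conjTranspose (hy μ x).1 (hy μ x).2
  have h3 : exp (-(p.1 (x.shift μ))) ∈ Matrix.specialUnitaryGroup (Fin N) ℂ :=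
    exp_mem_specialUnitaryGroup_of_conjTranspose (by rw [Matrix.conjTranspose_neg, (hφ _).1, neg_neg])
      (by rw [Matrix.trace_neg, (hφ _).2, neg_zero])
  exact Submonoid.mul_mem _ (Submonoid.mul_mem _ (Submonoid.mul_mem _ h1 h2) (hL (x, μ))) h3

/-- The left fluctuation `W = orbitFluct · Lᴴ` is special unitary on `𝔰𝔲` data. [folklore] -/
theorem orbitFluct_mul_conjTranspose_mem_specialUnitaryGroup (hL : ∀ e, L e ∈ Matrix.specialUnitaryGroup (Fin N) ℂ)
    {p : (FinTorusSite n₀ n₁ n₂ n₃ → Matrix (Fin N) (Fin N) ℂ) × (Fin 4 → FinTorusSite n₀ n₁ n₂ n₃ → Matrix (Fin N) (Fin N) ℂ)}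
    (hφ : ∀ x, (p.1 x)ᴴ = -p.1 x ∧ (p.1 x).trace = 0) (hy : ∀ μ x, (p.2 μ x)ᴴ = -p.2 μ x ∧ (p.2 μ x).trace = 0)
    (μ : Fin 4) (x : FinTorusSite n₀ n₁ n₂ n₃) : orbitFluct L p μ x * (L (x, μ))ᴴ ∈ Matrix.specialUnitaryGroup (Fin N) ℂ :=
  Submonoid.mul_mem _ (orbitFluct_mem_specialUnitaryGroup hL hφ hy μ x) (conjTranspose_mem_specialUnitaryGroup (hL (x, μ)))

/-- The components of the chart are continuous at `0` (unitary background). [folklore] -/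
theorem continuousAt_slicePsi_apply_zero (hL : ∀ e, L e ∈ Matrix.unitaryGroup (Fin N) ℂ) (μ : Fin 4) (x : FinTorusSite n₀ n₁ n₂ n₃) :
    ContinuousAt (fun p : (FinTorusSite n₀ n₁ n₂ n₃ → Matrix (Fin N) (Fin N) ℂ) × (Fin 4 → FinTorusSite n₀ n₁ n₂ n₃ → Matrix (Fin N) (Fin N) ℂ) =>
      slicePsi L p μ x) 0 := by
  have h1 : ContinuousAt (slicePsi L) 0 :=
    (contDiffAt_slicePsi (n := 0) fun μ x => by rw [orbitFluct_zero_mul_conjTranspose hL, sub_self, norm_zero]; exact one_pos).continuousAt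
  exact (((continuous_apply x).comp (continuous_apply μ)).continuousAt).comp h1

/-- ★★ **NEAR `0`, ON `𝔰𝔲` DATA, THE CHART IS `𝔰𝔲(N)`-VALUED**: eventually in `p → 0`, if `φ` and `y` are skew-Hermitian and traceless and
`L ∈ SU(N)^E`, then every `Ψ(p)_μ(x)` is skew-Hermitian (`log` of a unitary within `1/4` of `1`, Federbush) and traceless (`e^{tr log W} = det W = 1`,
`|tr log W| < 2π` by continuity at `0`). [cite: Helgason2000, Ch. I §1 Thm 1.14 p. 96] [cite: MontvayMunster1994, §3.2.5 p. 122] -/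
theorem eventually_slicePsi_skew_traceless (hL : ∀ e, L e ∈ Matrix.specialUnitaryGroup (Fin N) ℂ) :
    ∀ᶠ p in 𝓝 (0 : (FinTorusSite n₀ n₁ n₂ n₃ → Matrix (Fin N) (Fin N) ℂ) × (Fin 4 → FinTorusSite n₀ n₁ n₂ n₃ → Matrix (Fin N) (Fin N) ℂ)),
      (∀ x, (p.1 x)ᴴ = -p.1 x ∧ (p.1 x).trace = 0) → (∀ μ x, (p.2 μ x)ᴴ = -p.2 μ x ∧ (p.2 μ x).trace = 0) →
        ∀ μ x, (slicePsi L p μ x)ᴴ = -slicePsi L p μ x ∧ (slicePsi L p μ x).trace = 0 := by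
  have hLu : ∀ e, L e ∈ Matrix.unitaryGroup (Fin N) ℂ := fun e => (Matrix.mem_specialUnitaryGroup_iff.1 (hL e)).1
  have h4 := eventually_norm_orbitFluct_mul_conjTranspose_sub_one_lt hLu (by norm_num : (0 : ℝ) < 1 / 4)
  have htr : ∀ᶠ p in 𝓝 (0 : (FinTorusSite n₀ n₁ n₂ n₃ → Matrix (Fin N) (Fin N) ℂ) × (Fin 4 → FinTorusSite n₀ n₁ n₂ n₃ → Matrix (Fin N) (Fin N) ℂ)),
      ∀ μ x, ‖(slicePsi L p μ x).trace‖ < 2 * Real.pi := by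
    refine Filter.eventually_all.2 fun μ => Filter.eventually_all.2 fun x => ?_
    have hc : ContinuousAt (fun p : (FinTorusSite n₀ n₁ n₂ n₃ → Matrix (Fin N) (Fin N) ℂ) ×
        (Fin 4 → FinTorusSite n₀ n₁ n₂ n₃ → Matrix (Fin N) (Fin N) ℂ) => (slicePsi L p μ x).trace) 0 :=
      (continuous_id.matrix_trace.continuousAt).comp (continuousAt_slicePsi_apply_zero hLu μ x)
    have h := Metric.tendsto_nhds.1 hc (2 * Real.pi) (by positivity)
    refine h.mono fun p hp => ?_
    dsimp only at hp
    rwa [slicePsi_zero hLu, Pi.zero_apply, Pi.zero_apply, Matrix.trace_zero, dist_zero_right] at hp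
  filter_upwards [h4, htr] with p hp4 hptr hφ hy μ x
  set W := orbitFluct L p μ x * (L (x, μ))ᴴ with hW
  have hWsu : W ∈ Matrix.specialUnitaryGroup (Fin N) ℂ := orbitFluct_mul_conjTranspose_mem_specialUnitaryGroup hL hφ hy μ x
  have hWu : W ∈ Matrix.unitaryGroup (Fin N) ℂ := (Matrix.mem_specialUnitaryGroup_iff.1 hWsu).1
  have hW1 : ‖W - 1‖ < 1 := by linarith [hp4 μ x]
  refine ⟨?_, ?_⟩
  · have h := star_mlog_of_mem_unitaryGroup hWu (hp4 μ x)
    rw [slicePsi_apply, ← Matrix.star_eq_conjTranspose]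
    exact h
  · have hexp : exp (mlog W) = W := exp_mlog hW1
    have hdet : (exp (mlog W)).det = 1 := by rw [hexp]; exact (Matrix.mem_specialUnitaryGroup_iff.1 hWsu).2
    rw [det_exp_eq_exp_trace] at hdet
    have hC : Complex.exp (mlog W).trace = 1 := by rw [Complex.exp_eq_exp_ℂ]; exact hdet
    obtain ⟨n, hn⟩ := Complex.exp_eq_one_iff.1 hC
    have hlt : ‖(mlog W).trace‖ < 2 * Real.pi := hptr μ x
    have h2π : ‖(2 * (Real.pi : ℂ) * Complex.I)‖ = 2 * Real.pi := by simp [abs_of_pos Real.pi_pos]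
    have hnorm : ‖(mlog W).trace‖ = |(n : ℝ)| * (2 * Real.pi) := by rw [hn, norm_mul, Complex.norm_intCast, h2π]
    have hlt' : |(n : ℝ)| * (2 * Real.pi) < 1 * (2 * Real.pi) := by rw [← hnorm]; linarith
    have hn0 : |(n : ℝ)| < 1 := lt_of_mul_lt_mul_right hlt' (by positivity)
    have hn00 : n = 0 := by
      have h' : |n| < 1 := by exact_mod_cast hn0
      exact Int.abs_lt_one_iff.mp h'
    rw [slicePsi_apply, hn, hn00]
    simp

end SU

end Summit.QuantumFields.YangMills.Cruxes.IRcof.TwistedSlab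

end
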